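import Summits.ValiantsHypothesis.ValiantsHypothesis.Theorems.LacunarySymmetroidMatrixDescartesCensusCUPieces

/-!
# `MatrixDescartes` census — chamber-uniform checker, third layer: magnitude-row case splits over second-layer certificates

HONEST FRAMING.  Object-search cell `pub-symmetroid`; door-A item `DoorA26 = PosRootLawAt 2 6 19`
(stmt-ValiantsHypothesis-19979; OPEN, typed, never asserted).  A thin third certificate layer `CU.Cert3` on top of the landed
second layer (`…CensusCUPieces`, `CU.Cert2`: argmax piece splits and signed rank rows): a node is a `CU.Cert2`, an exponent split
(`h ≥ 0` / `−h ≥ 0` for a linear form `h` in the exponents), or a MAGNITUDE split on a row `Σ_t w_t · log x_t ≤ log (kn / kd)` versus its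
negation — the shape of engine val-sym-eng-1's ONE-SPLIT certificates («competitor `b` small against the anchor `t₀`: drop it with the
bound `u_b = ratio · θ`; competitor `b` large: a second signed rank row certified with the extra magnitude row»).  The first layer
already has this split (`CU.Cert.splitL`) but only over first-layer leaves; here the branches are second-layer certificates.
Soundness `CU.certOK3_sound` (one of the two rows holds), main theorems `CU.posRootLawOn_of_checkChamber3`,
`CU.doorA26_on_chambers_of_checkTable3`.  Nothing here bears on `V = 19`, on `DoorA26` itself (OPEN), on `MatrixDescartes`
(stmt-ValiantsHypothesis-18050) or on `VP ≠ VNP`.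

[folklore] Certificate-checker definitions and soundness; elementary.
-/

-- the D-0017 layout repeats a namespace component (single-conjunct summit); the `dupNamespace` linter flags it; name mandated.
set_option linter.dupNamespace false

namespace Summit.ValiantsHypothesis.ValiantsHypothesis.Theorems.LacunarySymmetroidMatrixDescartes.Census.CU

open V20 (Atom aval Epos pdet)

/-! ## Certificates with magnitude splits over the second layer -/

/-- Third-layer certificates: a second-layer node, a binary exponent split, or a binary magnitude split. [folklore] -/
inductive Cert3 where
  /-- a second-layer certificate -/
  | node (c : Cert2)
  /-- case split on the sign of the linear form `h` in the exponents (`h ≥ 0` / `−h ≥ 0`) -/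
  | splitD (h : LinD) (pos neg : Cert3)
  /-- case split on a magnitude row: `Σ w ℓ ≤ log (kn / kd)` / `Σ (−w) ℓ ≤ log (kd / kn)` -/
  | splitL (w : List ℤ) (kn kd : ℕ) (le ge : Cert3)

/-- Check a third-layer certificate against the two contexts (exponent forms known `≥ 0`, magnitude rows known to hold). [folklore] -/
def certOK3 (ord : List Atom) (s : Bool) : List LinD → List LRow → Cert3 → Bool
  | ctx, ctxL, .node c => certOK2 ord s ctx ctxL c
  | ctx, ctxL, .splitD h cp cn => certOK3 ord s (ctx ++ [h]) ctxL cp && certOK3 ord s (ctx ++ [ldSmul (-1) h]) ctxL cn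
  | ctx, ctxL, .splitL w kn kd cle cge =>
    decide (w.length = 21) && decide (0 < kn) && decide (0 < kd) &&
      certOK3 ord s ctx (ctxL ++ [⟨w, kn, kd⟩]) cle && certOK3 ord s ctx (ctxL ++ [⟨vSmul (-1) w, kd, kn⟩]) cge

/-- **Check a chamber** with third-layer certificates for both orientations. [folklore] -/
def checkChamber3 (ord : List Atom) (cpos cneg : Cert3) : Bool :=
  ordAtomsOK ord && certOK3 ord true (baseCtx ord) [] cpos && certOK3 ord false (baseCtx ord) [] cneg

/-! ## Soundness -/

variable {ord : List Atom} {s : Bool} {x : ℕ → ℝ} {v : Atom → ℝ} (d : Fin 6 → ℕ)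

/-- **Soundness of the third-layer checker (abstract form).** [folklore] -/
theorem certOK3_sound (hordA : ordAtomsOK ord = true) (M : Model (dlist d) ord s x v) :
    ∀ (c : Cert3) (ctx : List LinD) (ctxL : List LRow), (∀ G ∈ ctx, 0 ≤ G.ev d) → (∀ r ∈ ctxL, r.Holds (ell x) ∧ r.WF) →
      certOK3 ord s ctx ctxL c = true → False
  | .node c, ctx, ctxL, hctx, hctxL, h => certOK2_sound d hordA M c ctx ctxL hctx hctxL h
  | .splitD hF cp cn, ctx, ctxL, hctx, hctxL, h => by
    unfold certOK3 at h
    simp only [Bool.and_eq_true] at h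
    obtain ⟨hp, hn⟩ := h
    rcases le_total 0 (hF.ev d) with hle | hle
    · exact certOK3_sound hordA M cp (ctx ++ [hF]) ctxL
        (fun G hG => by
          rcases List.mem_append.1 hG with hG | hG
          · exact hctx G hG
          · simp at hG; rw [hG]; exact hle) hctxL hp
    · exact certOK3_sound hordA M cn (ctx ++ [ldSmul (-1) hF]) ctxL
        (fun G hG => by
          rcases List.mem_append.1 hG with hG | hG
          · exact hctx G hG
          · simp at hG; rw [hG, ev_ldSmul]; linarith) hctxL hn
  | .splitL w kn kd cle cge, ctx, ctxL, hctx, hctxL, h => by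
    unfold certOK3 at h
    simp only [Bool.and_eq_true, decide_eq_true_eq] at h
    obtain ⟨⟨⟨⟨hw, hkn⟩, hkd⟩, hle⟩, hge⟩ := h
    rcases le_total (vdot w (ell x)) (Real.log ((kn : ℝ) / kd)) with hc | hc
    · exact certOK3_sound hordA M cle ctx (ctxL ++ [⟨w, kn, kd⟩]) hctx
        (fun r hr => by
          rcases List.mem_append.1 hr with hr | hr
          · exact hctxL r hr
          · simp at hr; subst hr; exact ⟨hc, hkn, hkd, hw⟩) hle
    · exact certOK3_sound hordA M cge ctx (ctxL ++ [⟨vSmul (-1) w, kd, kn⟩]) hctx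
        (fun r hr => by
          rcases List.mem_append.1 hr with hr | hr
          · exact hctxL r hr
          · simp at hr; subst hr
            refine ⟨?_, hkd, hkn, by simp [length_vSmul, hw]⟩
            unfold LRow.Holds
            simp only
            rw [vdot_vSmul]
            have hknR : (0 : ℝ) < kn := by exact_mod_cast hkn
            have hkdR : (0 : ℝ) < kd := by exact_mod_cast hkd
            rw [Real.log_div hkdR.ne' hknR.ne']
            rw [Real.log_div hknR.ne' hkdR.ne'] at hc
            push_cast; linarith) hge

/-- **Main theorem (third layer, abstract order).** [folklore] -/
theorem posRootLawOn_of_checkChamber3 (σ : Fin 21 → Fin 6 × Fin 6) (cpos cneg : Cert3)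
    (h : checkChamber3 (ofSigma σ) cpos cneg = true) (d : Fin 6 → ℕ)
    (hd : StrictMono ((fun p : Fin 6 × Fin 6 => d p.1 + d p.2) ∘ σ)) : PosRootLawOn 2 6 19 d := by
  unfold checkChamber3 at h
  simp only [Bool.and_eq_true] at h
  obtain ⟨⟨hA, hp⟩, hn⟩ := h
  have hord := ordOK_of_chamber σ hA d hd
  intro S hS
  by_contra hlt
  have h20 : 20 ≤ ((pdet (dlist d) S).roots.toFinset.filter (fun t => 0 < t)).card := by
    unfold pdet; rw [dfun_dlist]; push Not at hlt; exact hlt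
  obtain ⟨x, M⟩ := model_of_twenty hord hS h20
  have hctx : ∀ G ∈ baseCtx (ofSigma σ), 0 ≤ G.ev d := by
    intro G hG
    unfold baseCtx at hG
    rw [List.mem_map] at hG
    obtain ⟨i, hi, rfl⟩ := hG
    rw [List.mem_range] at hi
    have := one_le_pairForm d hA M.toV20 rfl (p := (i, i + 1)) ⟨Nat.lt_succ_self i, by omega⟩
    omega
  by_cases hs : 0 < (pdet (dlist d) S).coeff (Epos (dlist d) (ofSigma σ) 0)
  · rw [show decide (0 < (pdet (dlist d) S).coeff (Epos (dlist d) (ofSigma σ) 0)) = true by simp [hs]] at M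
    exact certOK3_sound d hA M cpos _ [] hctx (by simp) hp
  · rw [show decide (0 < (pdet (dlist d) S).coeff (Epos (dlist d) (ofSigma σ) 0)) = false by simp [hs]] at M
    exact certOK3_sound d hA M cneg _ [] hctx (by simp) hn

/-- A table of third-layer chamber certificates. [folklore] -/
abbrev Table3 := List (ℕ × Cert3 × Cert3)

/-- Check a third-layer table against the chamber table of record. [folklore] -/
noncomputable def checkTable3 (T : Table3) : Bool := T.all fun e => checkChamber3 (ofSigma (chamber e.1)) e.2.1 e.2.2

/-- **Every chamber of an accepted third-layer table carries the door-A row.** [folklore] -/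
theorem doorA26_on_chambers_of_checkTable3 (T : Table3) (h : checkTable3 T = true) :
    ∀ n ∈ T.map Prod.fst, ∀ d : Fin 6 → ℕ,
      StrictMono ((fun p : Fin 6 × Fin 6 => d p.1 + d p.2) ∘ chamber n) → PosRootLawOn 2 6 19 d := by
  intro n hn d hd
  rw [List.mem_map] at hn
  obtain ⟨e, he, rfl⟩ := hn
  unfold checkTable3 at h
  rw [List.all_eq_true] at h
  exact posRootLawOn_of_checkChamber3 (chamber e.1) e.2.1 e.2.2 (h e he) d hd

end Summit.ValiantsHypothesis.ValiantsHypothesis.Theorems.LacunarySymmetroidMatrixDescartes.Census.CU
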